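import Summits.MatrixMultiplication.MatrixMultiplication.Theorems.OutsiderSandwichDegenerationWitnessRestrictions

/-!
# OutsiderSandwich — degeneration witnesses, PART 2 of 3 (route-free helper)

LANDING SPLIT (decomp-mm-lander-1 g1, 2026-08-30; mechanical, for the 400-line lint) of the lens-4 gen-7 landing form
`OutsiderSandwichDegenerationWitness.lean` (sha256 `b3aed0e0…4934`, 767 lines; critic-CLEARED decomp-mm STATUS l.342,
rc0 · 0 sorry · std axioms; REQUESTS #14).  This part = source sections «Elementary analysis», «One degeneration witness gives ω-free rate rungs» (source lines 289–429), copied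
byte-identically EXCEPT one gate-forced dedup edit: the folklore lemma `add_two_le_two_pow_succ` (≡ the landed `Literature.Barriers.PneNP.Locality.add_two_le_two_pow_succ`, dedup.landed) is deleted and re-created as a local `have` (same statement, same proof) inside its user(s).  It imports PART 1 (`…DegenerationWitnessRestrictions.lean`) and NO `Theses` file.  PART 3 = `…DegenerationWitness.lean` proves the asides 30534–30538 BY NAME.  Supports item `stmt-MatrixMultiplication-30534`; nothing here proves ω = 2.
-/

set_option linter.dupNamespace false

namespace Summit.MatrixMultiplication.MatrixMultiplication.Theorems.OutsiderSandwichDegenerationWitness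

open Polynomial
open Literature.Computability.AlgebraicComplexity

/-! ## Elementary analysis: the padding `2(j+h+1)` is negligible against `2^j` -/

section Analysis

/-- The padding length `L = 2(j+h+1)` serves the `2^j`-th power of an order-`h` degeneration:
`(h·2^j + 1)² ≤ 2^{2(j+h+1)}`. [folklore] -/
theorem pad_bound (h j : ℕ) : (h * 2 ^ j + 1) ^ 2 ≤ 2 ^ (2 * (j + h + 1)) := by
  -- `h + 2 ≤ 2^{h+1}` [folklore] — a local copy: the identical lemma is LANDED cross-area as
  -- `Literature.Barriers.PneNP.Locality.add_two_le_two_pow_succ` (gate dedup.landed); not imported here.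
  have add_two_le_two_pow_succ : ∀ h : ℕ, h + 2 ≤ 2 ^ (h + 1) := by
    intro h
    induction h with
    | zero => norm_num
    | succ n ih => rw [pow_succ]; omega
  have h0 : 1 ≤ 2 ^ j := Nat.one_le_two_pow
  have h1 : h * 2 ^ j + 1 ≤ 2 ^ (j + h + 1) := by
    calc h * 2 ^ j + 1 ≤ (h + 2) * 2 ^ j := by nlinarith
      _ ≤ 2 ^ (h + 1) * 2 ^ j := Nat.mul_le_mul_right _ (add_two_le_two_pow_succ h)
      _ = 2 ^ (j + h + 1) := by rw [← pow_add]; ring_nf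
  calc (h * 2 ^ j + 1) ^ 2 ≤ (2 ^ (j + h + 1)) ^ 2 := Nat.pow_le_pow_left h1 2
    _ = 2 ^ (2 * (j + h + 1)) := by rw [← pow_mul]; ring_nf

/-- `(j + h + 1)/2^j → 0`. [folklore] -/
theorem tendsto_pad_div (h : ℕ) :
    Filter.Tendsto (fun j : ℕ => ((j : ℝ) + h + 1) / 2 ^ j) Filter.atTop (nhds 0) := by
  have h1 : Filter.Tendsto (fun j : ℕ => (j : ℝ) / 2 ^ j) Filter.atTop (nhds 0) := by
    simpa using tendsto_pow_const_div_const_pow_of_one_lt 1 (one_lt_two : (1 : ℝ) < 2)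
  have h2 : Filter.Tendsto (fun j : ℕ => ((h : ℝ) + 1) / 2 ^ j) Filter.atTop (nhds 0) := by
    have h3 := (tendsto_pow_atTop_nhds_zero_of_lt_one (r := (1 / 2 : ℝ)) (by norm_num)
      (by norm_num)).const_mul ((h : ℝ) + 1)
    rw [mul_zero] at h3
    refine h3.congr fun j => ?_
    rw [one_div, inv_pow, div_eq_mul_inv]
  have h4 := h1.add h2
  rw [add_zero] at h4
  refine h4.congr fun j => ?_
  ring

/-- `m ≥ 1` and `2 log m ≤ x log 2` give `m² ≤ 2^x`. [folklore] -/
theorem sq_le_two_rpow_of_log {m : ℕ} (hm : 1 ≤ m) {x : ℝ}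
    (h : 2 * Real.log m ≤ x * Real.log 2) : (m : ℝ) ^ 2 ≤ (2 : ℝ) ^ x := by
  have hmpos : (0 : ℝ) < m := by exact_mod_cast hm
  rw [Real.rpow_def_of_pos (by norm_num : (0 : ℝ) < 2), ← Real.exp_log (pow_pos hmpos 2),
    Real.exp_le_exp, Real.log_pow]
  push_cast
  linarith

/-- `m ≥ 1` and `m² ≤ 2^x` give `2 log m ≤ x log 2`. [folklore] -/
theorem log_le_of_sq_le_two_rpow {m : ℕ} (hm : 1 ≤ m) {x : ℝ}
    (h : (m : ℝ) ^ 2 ≤ (2 : ℝ) ^ x) : 2 * Real.log m ≤ x * Real.log 2 := by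
  have hmpos : (0 : ℝ) < m := by exact_mod_cast hm
  have hlog := Real.log_le_log (pow_pos hmpos 2) h
  rw [Real.log_pow, Real.log_rpow (by norm_num)] at hlog
  push_cast at hlog
  exact hlog

end Analysis

/-! ## One degeneration witness gives ω-free rate rungs for every `c` with `c^N < m²` -/

section Rate

/-- The honest restriction extracted from an order-`h` degeneration witness at its `2^j`-th power:
`⟨m^{2^j}⟩³ ≤ cw₂^{⊠(N·2^j + 2(j+h+1))}`. [cite: BurgisserClausenShokrollahi1997, (15.26)] -/
theorem restrictsTo_level {N m h : ℕ}
    {A : (Fin m × Fin m) → (Fin N → Fin 3) → ℂ[X]} {B : (Fin m × Fin m) → (Fin N → Fin 3) → ℂ[X]}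
    {C : (Fin m × Fin m) → (Fin N → Fin 3) → ℂ[X]}
    (hd : IsApproxRestriction h (kroneckerPow (cwTensor ℂ 2) N) (matMulTensor ℂ m m m) A B C)
    (j : ℕ) :
    TensorRestrictsTo (kroneckerPow (cwTensor ℂ 2) (N * 2 ^ j + 2 * (j + h + 1)))
      (matMulTensor ℂ (m ^ 2 ^ j) (m ^ 2 ^ j) (m ^ 2 ^ j)) := by
  obtain ⟨k, hk⟩ : ∃ k, 2 ^ j = k + 1 := ⟨2 ^ j - 1, (Nat.sub_add_cancel Nat.one_le_two_pow).symm⟩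
  rw [hk]
  exact restrictsTo_pow_pad_of_isApproxRestriction hd k _ (by rw [← hk]; exact pad_bound h j)

/-- For `c > 1` with `c^N < m²`, the padded levels eventually carry rate `c`:
`c^{N·2^j + 2(j+h+1)} ≤ (m^{2^j})²` for all large `j`. [folklore] -/
theorem eventually_rate (N m h : ℕ) {c : ℝ} (hc1 : 1 < c) (hc : c ^ N < (m : ℝ) ^ 2) :
    ∀ᶠ j : ℕ in Filter.atTop,
      c ^ (N * 2 ^ j + 2 * (j + h + 1)) ≤ ((m : ℝ) ^ 2 ^ j) ^ 2 := by
  have hcN : 0 < c ^ N := pow_pos (by linarith) N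
  set g : ℝ := (m : ℝ) ^ 2 / c ^ N with hg
  have hg1 : 1 < g := (one_lt_div hcN).mpr hc
  have hlogc : 0 < Real.log c := Real.log_pos hc1
  have hlogg : 0 < Real.log g := Real.log_pos hg1
  have hη : 0 < Real.log g / (2 * Real.log c) := by positivity
  filter_upwards [(tendsto_pad_div h).eventually (gt_mem_nhds hη)] with j hj
  have h2j : (0 : ℝ) < 2 ^ j := by positivity
  have hj' : (j : ℝ) + h + 1 < Real.log g / (2 * Real.log c) * 2 ^ j := (div_lt_iff₀ h2j).mp hj
  have key : 2 * ((j : ℝ) + h + 1) * Real.log c ≤ 2 ^ j * Real.log g := by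
    have h5 := mul_lt_mul_of_pos_left hj' (by positivity : (0 : ℝ) < 2 * Real.log c)
    have e : 2 * Real.log c * (Real.log g / (2 * Real.log c) * 2 ^ j) = 2 ^ j * Real.log g := by
      field_simp
    rw [e] at h5
    linarith
  have e3 : c ^ N * g = (m : ℝ) ^ 2 := by
    rw [hg]
    field_simp
  have e1 : c ^ (N * 2 ^ j + 2 * (j + h + 1)) = (c ^ N) ^ 2 ^ j * c ^ (2 * (j + h + 1)) := by
    rw [pow_add, pow_mul]
  have e2 : ((m : ℝ) ^ 2 ^ j) ^ 2 = (c ^ N) ^ 2 ^ j * g ^ 2 ^ j := by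
    rw [← mul_pow, e3, ← pow_mul, ← pow_mul, mul_comm]
  rw [e1, e2]
  refine mul_le_mul_of_nonneg_left ?_ (by positivity)
  rw [← Real.log_le_log_iff (by positivity) (by positivity), Real.log_pow, Real.log_pow]
  push_cast
  linarith

/-- **One degeneration witness ⟹ ω-free rate rungs.**  If `⟨m,m,m⟩ ⊴ cw₂^{⊠N}` (any `N`, any
approximation order) and `c ≥ 0` has `c^N < m²`, then for every `N₀` there are `N' ≥ N₀` and `m'`
with an honest restriction `⟨m',m',m'⟩ ≤ cw₂^{⊠N'}` and `c^{N'} ≤ m'²` — i.e. the route's rung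
`CwTwoRate c`.  So the census may certify DEGENERATIONS (e.g. `⟨3,3,3⟩ ⊴ cw₂^{⊠3}`, order `1`,
numerically found 2026-08-30: every `c < 9^{1/3} = 2.0801`) and feed the same ladder as restrictions.
[cite: BurgisserClausenShokrollahi1997, (15.26)] -/
theorem rate_of_algDegeneratesTo {N m : ℕ}
    (hd : AlgDegeneratesTo (kroneckerPow (cwTensor ℂ 2) N) (matMulTensor ℂ m m m))
    {c : ℝ} (hc0 : 0 ≤ c) (hc : c ^ N < (m : ℝ) ^ 2) :
    ∀ N₀ : ℕ, ∃ N' : ℕ, N₀ ≤ N' ∧ ∃ m' : ℕ,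
      TensorRestrictsTo (kroneckerPow (cwTensor ℂ 2) N') (matMulTensor ℂ m' m' m') ∧
        c ^ N' ≤ (m' : ℝ) ^ 2 := by
  intro N₀
  obtain ⟨h, A, B, C, hd⟩ := hd
  have hm : 1 ≤ m := by
    rcases Nat.eq_zero_or_pos m with rfl | hm
    · exfalso
      have : (0 : ℝ) < ((0 : ℕ) : ℝ) ^ 2 := lt_of_le_of_lt (pow_nonneg hc0 N) hc
      simp at this
    · exact hm
  have hlev : ∀ j : ℕ, N₀ ≤ j → N₀ ≤ N * 2 ^ j + 2 * (j + h + 1) := fun j hj =>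
    hj.trans ((show j ≤ 2 * (j + h + 1) by omega).trans (Nat.le_add_left _ _))
  rcases le_or_gt c 1 with hc1 | hc1
  · refine ⟨N * 2 ^ N₀ + 2 * (N₀ + h + 1), hlev N₀ le_rfl, m ^ 2 ^ N₀, restrictsTo_level hd N₀, ?_⟩
    have h1 : (1 : ℝ) ≤ ((m ^ 2 ^ N₀ : ℕ) : ℝ) := by exact_mod_cast Nat.one_le_pow _ _ hm
    calc c ^ (N * 2 ^ N₀ + 2 * (N₀ + h + 1)) ≤ 1 := pow_le_one₀ hc0 hc1
      _ ≤ ((m ^ 2 ^ N₀ : ℕ) : ℝ) ^ 2 := by nlinarith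
  · obtain ⟨j, hj1, hj2⟩ :=
      ((eventually_rate N m h hc1 hc).and (Filter.eventually_ge_atTop N₀)).exists
    refine ⟨N * 2 ^ j + 2 * (j + h + 1), hlev j hj2, m ^ 2 ^ j, restrictsTo_level hd j, ?_⟩
    push_cast
    exact hj1

end Rate

end Summit.MatrixMultiplication.MatrixMultiplication.Theorems.OutsiderSandwichDegenerationWitness
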